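import Mathlib
import HarnessLib
import Summits.NavierStokesRegularity.NavierStokesRegularity.Theorems.HalfSpaceWindowDoorCirculationCarryingRigidityDefs
import Summits.NavierStokesRegularity.NavierStokesRegularity.Theorems.HalfSpaceWindowDoorCirculationCarryingRigidityReduction
import Summits.NavierStokesRegularity.NavierStokesRegularity.Theorems.HalfSpaceWindowDoorCirculationCarryingRigidityCriticalStretchingAnalytic
import Summits.NavierStokesRegularity.NavierStokesRegularity.Theorems.HalfSpaceWindowDoorCirculationCarryingRigidityWindowedFlux
import Literature.Analysis.UnboundedOperators.HeatKernelBoundedData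
import Literature.Analysis.FluidPDE.AxisymNoSwirlVorticity
import Summits.NavierStokesRegularity.NavierStokesRegularity.Theorems.HalfSpaceWindowDoorCirculationCarryingRigidityPlaneFluxDynamics
import Summits.NavierStokesRegularity.NavierStokesRegularity.Theorems.HalfSpaceWindowDoorCirculationCarryingRigidityTiltingIdentity
import Summits.NavierStokesRegularity.NavierStokesRegularity.Theorems.HalfSpaceWindowDoorCirculationCarryingRigidityTiltingFlux
import Literature.Analysis.UnboundedOperators.HeatKernelHeatEquation
import Literature.Analysis.UnboundedOperators.HeatFlowCalculus
import Literature.Analysis.UnboundedOperators.HeatExtensionHarnack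
import Literature.Analysis.UnboundedOperators.HeatKernelGradient
import Literature.Analysis.UnboundedOperators.HeatKernelReversePoincare
import Literature.Analysis.FluidPDE.AxisymNoSwirlImpulseSlice
import Literature.Analysis.FluidPDE.AxisymHouLiVariables
import Literature.Analysis.Calculus.IicRpowTails
import Literature.Analysis.FluidPDE.ConstantinFeffermanStretching
import Summits.NavierStokesRegularity.NavierStokesRegularity.Theorems.PoloidalWindowDoorPoloidalWindowRigidityScrewKinematics

/-!
# Route `HalfSpaceWindowDoor`, crux `CirculationCarryingRigidity` (stmt-NavierStokesRegularity-25311) — line «gauss-swirl»,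
# part `GaussKernel`: slice/coordinate helpers, the translated 3D heat kernel `G_t(x−x₀)` and its gradient, Gaussian moments and the
whole-space Gaussian integration by parts for LINEAR-GROWTH observables (`integral_G_mul_fderiv_eq_lin`)

LINE «gauss-swirl» = ideator ns-idea-4 g11 (D-0145, files-only; critic of record idea-crit-3: PASS, grade new-combination on the wall W6
`…Defs.HemisphereLiouvilleE3`), file of record `pub/ideators/ns-idea-4/lines/gauss-swirl/GaussSwirl_v1_4.lean` (sha16 9f36760ac8cb3b0a,
`lean check` rc 0, sorries 1 = the research statement K1 only), card `LINE-gauss-swirl_v1_4.md`, PORT-MAP.md 5a0f471fb69fa47f.  PORTED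
INTO THE TREE by the LEAD of 25311 (ns-hsw-p1 g6, cell pub-ns-dss) as census support `--supports stmt-NavierStokesRegularity-25311
--as helper`: the proof texts below are the ideator's, VERBATIM modulo the split into ≤ 400-line modules, the `E3 ↦ EuclideanSpace ℝ
(Fin 3)` spelling, the namespace, added one-line docstrings and two `_`-renamings for the unused-variable linter; the vocabulary
(`InDoorClass`, `SignE3`, `gauss`, `angMom`, `gaussAngMom` = 𝒢, `gaussInflow` = ℐ, and the obligation / stratum Props) lives in
`…CirculationCarryingRigidityDefs`.

THE LINE IN ONE PARAGRAPH.  2D one-signed vorticity has the exact law `d/dt∫|x|²ω = 4νΦ`, which alone kills ancient flows with `Φ > 0`;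
in the 3D closed hemisphere (`ω₃ ≥ 0`) it survives for the GAUSSIAN AXIAL ANGULAR MOMENTUM `𝒢(t;x₀) = t^{-3/2}∫e^{−|x−x₀|²/4t} g`
(`= 2t^{-1/2}∫e^{…}ω₃ ≥ 0`), because against the divergence-free Gaussian swirl field `K_t(x−x₀)·e₃×(x−x₀)` pressure AND vortex tilting
drop out exactly, leaving ONE signed residue, the inflow correlation `ℐ = t^{-3/2}∫e^{…}((x−x₀)·v) g`: `d𝒢/ds = −𝒢/(s₀−s) − ℐ/(2(s₀−s))`;
with the time-only Type-I rate `𝒢/(s₀−s) → 0` in the far past, so «no inflow about ONE space–time axis before some epoch ⇒ poloidal».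

WHAT THIS IS NOT: not a statement about Navier–Stokes regularity (Clay A).  The door statements are regularity CRITERIA about
HYPOTHETICAL blow-up profiles (KNSS ancient mild solutions); the research statement K1 `PersistentAxis` (⟺ the wall) is NOT proved,
NOT registered and nothing is closed by this file; item 25311 stays OPEN at its research stub.
-/

noncomputable section

-- the summit and its single sub-problem share the name (CONVENTIONS §1), as in every Theorems file
set_option linter.dupNamespace false

namespace Summit.NavierStokesRegularity.NavierStokesRegularity.Theorems.HalfSpaceWindowDoorCirculationCarryingRigidityGaussKernel


open scoped BigOperators Topology MeasureTheory InnerProductSpace RealInnerProductSpace Laplacian ContDiff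
open Filter Set Function MeasureTheory Metric
open Literature.Analysis Literature.Analysis.FluidPDE Literature.Analysis.UnboundedOperators
open Summit.NavierStokesRegularity.NavierStokesRegularity.Theses.HalfSpaceWindowDoor
open Summit.NavierStokesRegularity.NavierStokesRegularity.Theorems.HalfSpaceWindowDoorCirculationCarryingRigidityDefs
open Summit.NavierStokesRegularity.NavierStokesRegularity.Theorems.HalfSpaceWindowDoorCirculationCarryingRigidityReduction
  (circulationCarryingRigidity_of_hemisphereLiouvilleE3)
open Summit.NavierStokesRegularity.NavierStokesRegularity.Theorems.HalfSpaceWindowDoorCirculationCarryingRigidityCriticalStretchingAnalytic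
  (inner_curl_e3_eq_zero_of_far_past)
open Summit.NavierStokesRegularity.NavierStokesRegularity.Theorems.LocalSineTubeDoorProfileAlignedWindowRigidityAncient
  (bdd_of_hasTypeITimeDecay analyticOnNhd_slice)
open Summit.NavierStokesRegularity.NavierStokesRegularity.Theorems.PoloidalWindowDoorPoloidalWindowRigidityClassSpaceTimeRates
  (exists_fderiv_rate_of_class' exists_iteratedFDeriv_two_rate_of_class' exists_iteratedFDeriv_three_rate_of_class)
open Summit.NavierStokesRegularity.NavierStokesRegularity.Theorems.HalfSpaceWindowDoorCirculationCarryingRigidityPlaneFluxDynamics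
  (hasDerivAt_inner_curl_e3_convect)
open Summit.NavierStokesRegularity.NavierStokesRegularity.Theorems.HalfSpaceWindowDoorCirculationCarryingRigidityTiltingIdentity
  (convect_sub_stretch_two_eq_divh)
open Summit.NavierStokesRegularity.NavierStokesRegularity.Theorems.HalfSpaceWindowDoorCirculationCarryingRigidityTiltingFlux
  (contDiff_flux norm_flux_le norm_fderiv_flux_le)
open Summit.NavierStokesRegularity.NavierStokesRegularity.Theorems.HalfSpaceWindowDoorCirculationCarryingRigiditySubcriticalStretching
  (hasDerivAt_inner_curl_e3 fderiv_inner_e3_apply laplacian_inner_e3)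
open Summit.NavierStokesRegularity.NavierStokesRegularity.Theorems.HalfSpaceWindowDoorCirculationCarryingRigidityPlaneFluxHeightWindow
  (abs_inner_e3_le contDiff_one_curl)
open Summit.NavierStokesRegularity.NavierStokesRegularity.Theorems.HalfSpaceWindowDoorCirculationCarryingRigidityPlaneLaplacian
  (contDiff_two_curl norm_iteratedFDeriv_two_inner_e3_le)
open Summit.NavierStokesRegularity.NavierStokesRegularity.Theorems.ChiralWindowDoorClassDerivDecay (exists_classical_of_class)
open Summit.NavierStokesRegularity.NavierStokesRegularity.Theorems.PoloidalWindowDoorPoloidalWindowRigidityScrewKinematics (inner_eq_three)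

/-! ### §2b Gaussian kernel calculus on the time-only class (PROVED, v1.1): obligations O3 and O2 -/

/-- The Gaussian is the heat kernel up to its normalisation: `e^{−‖y‖²/4t} = (4πt)^{3/2} G_t(y)`. -/
theorem gauss_eq_heatKernel {t : ℝ} (ht : 0 < t) (x₀ x : (EuclideanSpace ℝ (Fin 3))) :
    gauss t x₀ x = (4 * Real.pi * t) ^ ((3 : ℝ) / 2) * heatKernel t (x - x₀) := by
  unfold gauss heatKernel
  rw [finrank_euclideanSpace_fin, ← mul_assoc, ← Real.rpow_add (by positivity)]
  norm_num

/-- `|g| ≤ 2‖y‖‖u‖`. -/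
theorem abs_angMom_le (x₀ : (EuclideanSpace ℝ (Fin 3))) (u : (EuclideanSpace ℝ (Fin 3)) → (EuclideanSpace ℝ (Fin 3))) (x : (EuclideanSpace ℝ (Fin 3))) :
    |angMom x₀ u x| ≤ 2 * ‖x - x₀‖ * ‖u x‖ := by
  have hc : ∀ (w : (EuclideanSpace ℝ (Fin 3))) (i : Fin 3), |w i| ≤ ‖w‖ := fun w i => by
    rw [← Real.norm_eq_abs]; exact PiLp.norm_apply_le w i
  unfold angMom
  calc |(x - x₀) 0 * u x 1 - (x - x₀) 1 * u x 0|
      ≤ |(x - x₀) 0 * u x 1| + |(x - x₀) 1 * u x 0| := abs_sub _ _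
    _ = |(x - x₀) 0| * |u x 1| + |(x - x₀) 1| * |u x 0| := by rw [abs_mul, abs_mul]
    _ ≤ ‖x - x₀‖ * ‖u x‖ + ‖x - x₀‖ * ‖u x‖ :=
        add_le_add (mul_le_mul (hc _ 0) (hc _ 1) (abs_nonneg _) (norm_nonneg _))
          (mul_le_mul (hc _ 1) (hc _ 0) (abs_nonneg _) (norm_nonneg _))
    _ = 2 * ‖x - x₀‖ * ‖u x‖ := by ring

/-- The scale algebra: `t^{−3/2}·(4πt)^{3/2} = (4π)^{3/2}`. -/
theorem rpow_scale {t : ℝ} (ht : 0 < t) :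
    t ^ (-(3 : ℝ) / 2) * (4 * Real.pi * t) ^ ((3 : ℝ) / 2) = (4 * Real.pi) ^ ((3 : ℝ) / 2) := by
  rw [Real.mul_rpow (by positivity) ht.le, mul_left_comm, ← mul_assoc, mul_assoc, ← Real.rpow_add ht]
  norm_num

/-- `t^{1/2}/√(−s) ≤ √2` when `t ≤ 2(−s)`. -/
theorem sqrt_ratio_le {t s : ℝ} (_ht : 0 < t) (hs : 0 < -s) (ht2 : t ≤ 2 * (-s)) :
    t ^ (1 / 2 : ℝ) / Real.sqrt (-s) ≤ Real.sqrt 2 := by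
  rw [← Real.sqrt_eq_rpow, div_le_iff₀ (Real.sqrt_pos.2 hs), ← Real.sqrt_mul (by norm_num : (0:ℝ) ≤ 2)]
  exact Real.sqrt_le_sqrt ht2

/-- `⟪w, e₃⟫ = w₂`. -/
theorem inner_e3_apply (w : (EuclideanSpace ℝ (Fin 3))) : ⟪w, e3⟫_ℝ = w 2 := by
  simp [e3, EuclideanSpace.inner_single_right]

section Slice
variable {V : (EuclideanSpace ℝ (Fin 3)) → (EuclideanSpace ℝ (Fin 3))}

/-- Components of a differentiable field: `∂_w (V · i) = (DV w) i`. -/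
theorem fderiv_apply3 (hV : Differentiable ℝ V) (i : Fin 3) (x w : (EuclideanSpace ℝ (Fin 3))) :
    fderiv ℝ (fun y => V y i) x w = fderiv ℝ V x w i := by
  have hproj := (EuclideanSpace.proj (𝕜 := ℝ) i).hasFDerivAt.comp x (hV x).hasFDerivAt
  have hfun : (fun y => V y i) = (EuclideanSpace.proj (𝕜 := ℝ) i) ∘ V := rfl
  rw [hfun, hproj.fderiv, ContinuousLinearMap.comp_apply]
  rfl

/-- Coordinates of a differentiable field are differentiable. -/
theorem differentiable_apply3 (hV : Differentiable ℝ V) (i : Fin 3) : Differentiable ℝ (fun y => V y i) :=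
  (EuclideanSpace.proj (𝕜 := ℝ) i).differentiable.comp hV

/-- Coordinates of a continuous field are continuous. -/
theorem continuous_apply3 (hV : Continuous V) (i : Fin 3) : Continuous (fun y => V y i) :=
  (EuclideanSpace.proj (𝕜 := ℝ) i).continuous.comp hV

/-- Coordinates of a continuous derivative are continuous. -/
theorem continuous_fderiv_apply3 (hV : Differentiable ℝ V) (hVc : Continuous (fderiv ℝ V)) (i : Fin 3) (w : (EuclideanSpace ℝ (Fin 3))) :
    Continuous (fun x => fderiv ℝ (fun y => V y i) x w) := by
  have hfun : (fun x => fderiv ℝ (fun y => V y i) x w) = fun x => (EuclideanSpace.proj (𝕜 := ℝ) i) (fderiv ℝ V x w) := by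
    funext x; rw [fderiv_apply3 hV]; rfl
  rw [hfun]
  exact (EuclideanSpace.proj (𝕜 := ℝ) i).continuous.comp (hVc.clm_apply continuous_const)

/-- A coordinate is bounded by the norm. -/
theorem abs_apply3_le (i : Fin 3) (x : (EuclideanSpace ℝ (Fin 3))) : |V x i| ≤ ‖V x‖ := by
  rw [← Real.norm_eq_abs]; exact PiLp.norm_apply_le (V x) i

/-- A matrix entry of the derivative is bounded by its operator norm. -/
theorem abs_fderiv_apply3_le (hV : Differentiable ℝ V) (i j : Fin 3) (x : (EuclideanSpace ℝ (Fin 3))) :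
    |fderiv ℝ (fun y => V y i) x (EuclideanSpace.single j 1)| ≤ ‖fderiv ℝ V x‖ := by
  rw [fderiv_apply3 hV, ← Real.norm_eq_abs]
  refine (PiLp.norm_apply_le _ i).trans ?_
  refine (ContinuousLinearMap.le_opNorm _ _).trans ?_
  rw [PiLp.norm_single, norm_one, mul_one]

end Slice

section Kernel
variable {t : ℝ} (x₀ : (EuclideanSpace ℝ (Fin 3)))

/-- The translated heat kernel `G(x) = G_t(x − x₀)` and its gradient `∇G(x) = −(G(x)/2t)(x − x₀)`. -/
theorem hasFDerivAt_G (t : ℝ) (x : (EuclideanSpace ℝ (Fin 3))) :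
    HasFDerivAt (fun y : (EuclideanSpace ℝ (Fin 3)) => heatKernel t (y - x₀)) ((-(heatKernel t (x - x₀) / (2 * t))) • innerSL ℝ (x - x₀)) x := by
  have h := (hasFDerivAt_heatKernel t (x - x₀)).comp x ((hasFDerivAt_id x).sub_const x₀)
  rw [ContinuousLinearMap.comp_id] at h
  exact h

/-- Partial derivatives of the translated heat kernel: `∂ⱼG_t(x−x₀) = −(G/2t)(x−x₀)ⱼ`. -/
theorem fderiv_G_apply (t : ℝ) (x : (EuclideanSpace ℝ (Fin 3))) (j : Fin 3) :
    fderiv ℝ (fun y : (EuclideanSpace ℝ (Fin 3)) => heatKernel t (y - x₀)) x (EuclideanSpace.single j 1) =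
      -(heatKernel t (x - x₀) / (2 * t)) * (x - x₀) j := by
  rw [(hasFDerivAt_G x₀ t x).fderiv, smul_apply, innerSL_apply_apply, EuclideanSpace.inner_single_right, RCLike.conj_to_real, one_mul, smul_eq_mul]

/-- `(x − x₀)ⱼ G(x) = −2t ∂ⱼG(x)` (`t ≠ 0`). -/
theorem coord_mul_G (ht : t ≠ 0) (x : (EuclideanSpace ℝ (Fin 3))) (j : Fin 3) :
    (x - x₀) j * heatKernel t (x - x₀) =
      -(2 * t) * fderiv ℝ (fun y : (EuclideanSpace ℝ (Fin 3)) => heatKernel t (y - x₀)) x (EuclideanSpace.single j 1) := by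
  rw [fderiv_G_apply]; field_simp

/-- The translated heat kernel is integrable. -/
theorem integrable_G (ht : 0 < t) : Integrable (fun y : (EuclideanSpace ℝ (Fin 3)) => heatKernel t (y - x₀)) :=
  (integrable_heatKernel_holds (E := (EuclideanSpace ℝ (Fin 3))) ht).comp_sub_right x₀

/-- The translated heat kernel is continuous. -/
theorem continuous_G (t : ℝ) : Continuous (fun y : (EuclideanSpace ℝ (Fin 3)) => heatKernel t (y - x₀)) :=
  (continuous_heatKernel t).comp (continuous_id.sub continuous_const)

/-- The partial derivatives of the translated heat kernel are integrable. -/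
theorem integrable_fderiv_G_apply (ht : 0 < t) (j : Fin 3) :
    Integrable (fun x : (EuclideanSpace ℝ (Fin 3)) => fderiv ℝ (fun y : (EuclideanSpace ℝ (Fin 3)) => heatKernel t (y - x₀)) x (EuclideanSpace.single j 1)) := by
  have hfun : (fun x : (EuclideanSpace ℝ (Fin 3)) => fderiv ℝ (fun y : (EuclideanSpace ℝ (Fin 3)) => heatKernel t (y - x₀)) x (EuclideanSpace.single j 1)) =
      fun x => -(1 / (2 * t)) * ((x - x₀) j * heatKernel t (x - x₀)) := by
    funext x; rw [fderiv_G_apply]; ring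
  rw [hfun]
  refine Integrable.const_mul ?_ _
  have h1 : Integrable (fun x : (EuclideanSpace ℝ (Fin 3)) => heatKernel t (x - x₀) * ‖x - x₀‖) :=
    (integrable_heatKernel_mul_norm (E := (EuclideanSpace ℝ (Fin 3))) ht).comp_sub_right x₀
  refine h1.mono' ?_ (ae_of_all _ fun x => ?_)
  · exact ((continuous_apply3 (V := fun x : (EuclideanSpace ℝ (Fin 3)) => x - x₀) (continuous_id.sub continuous_const) j).mul
      (continuous_G x₀ t)).aestronglyMeasurable
  · rw [Real.norm_eq_abs, abs_mul, abs_of_nonneg (heatKernel_pos ht _).le, mul_comm]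
    have hc : |(x - x₀) j| ≤ ‖x - x₀‖ := by rw [← Real.norm_eq_abs]; exact PiLp.norm_apply_le (x - x₀) j
    exact mul_le_mul_of_nonneg_left hc (heatKernel_pos ht _).le

end Kernel

section SliceExtra
variable {V : (EuclideanSpace ℝ (Fin 3)) → (EuclideanSpace ℝ (Fin 3))}

/-- Coordinates of a `C^n` field are `C^n`. -/
theorem contDiff_apply3 {n : WithTop ℕ∞} (hV : ContDiff ℝ n V) (i : Fin 3) : ContDiff ℝ n (fun y => V y i) :=
  (EuclideanSpace.proj (𝕜 := ℝ) i).contDiff.comp hV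

/-- The derivative of a coordinate is bounded by the derivative of the field. -/
theorem norm_fderiv_apply3_le (hV : Differentiable ℝ V) (i : Fin 3) (x : (EuclideanSpace ℝ (Fin 3))) :
    ‖fderiv ℝ (fun y => V y i) x‖ ≤ ‖fderiv ℝ V x‖ := by
  refine ContinuousLinearMap.opNorm_le_bound _ (norm_nonneg _) fun w => ?_
  rw [fderiv_apply3 hV, Real.norm_eq_abs]
  exact (abs_coord_le_norm_e3 _ i).trans (ContinuousLinearMap.le_opNorm _ _)

/-- expansion of a linear map on `ℝ³` in the standard frame -/
theorem clm_apply_eq_sum3 {F : Type*} [NormedAddCommGroup F] [NormedSpace ℝ F] (L : (EuclideanSpace ℝ (Fin 3)) →L[ℝ] F) (w : (EuclideanSpace ℝ (Fin 3))) :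
    L w = w 0 • L (EuclideanSpace.single 0 1) + w 1 • L (EuclideanSpace.single 1 1) + w 2 • L (EuclideanSpace.single 2 1) := by
  have hw : w = w 0 • (EuclideanSpace.single 0 (1 : ℝ) : (EuclideanSpace ℝ (Fin 3))) + w 1 • EuclideanSpace.single 1 1 +
      w 2 • EuclideanSpace.single 2 1 := by
    ext i; fin_cases i <;> simp
  conv_lhs => rw [hw]
  simp only [map_add, map_smul]

/-- the coordinate `y ↦ (y − x₀)ᵢ` -/
theorem hasFDerivAt_coord (x₀ x : (EuclideanSpace ℝ (Fin 3))) (i : Fin 3) :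
    HasFDerivAt (fun y : (EuclideanSpace ℝ (Fin 3)) => (y - x₀) i) (EuclideanSpace.proj (𝕜 := ℝ) i) x := by
  have h := (EuclideanSpace.proj (𝕜 := ℝ) i).hasFDerivAt.comp x ((hasFDerivAt_id x).sub_const x₀)
  rw [ContinuousLinearMap.comp_id] at h
  exact h

end SliceExtra

section Moments
variable {t : ℝ} (x₀ : (EuclideanSpace ℝ (Fin 3)))

/-- First Gaussian moment: `G_t(x−x₀)‖x−x₀‖` is integrable. -/
theorem integrable_G_mul_norm (ht : 0 < t) : Integrable (fun x : (EuclideanSpace ℝ (Fin 3)) => heatKernel t (x - x₀) * ‖x - x₀‖) :=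
  (integrable_heatKernel_mul_norm (E := (EuclideanSpace ℝ (Fin 3))) ht).comp_sub_right x₀

/-- Second Gaussian moment: `‖x−x₀‖²G_t(x−x₀)` is integrable. -/
theorem integrable_norm_sq_mul_G (ht : 0 < t) : Integrable (fun x : (EuclideanSpace ℝ (Fin 3)) => ‖x - x₀‖ ^ 2 * heatKernel t (x - x₀)) :=
  (integrable_norm_sq_mul_heatKernel (E := (EuclideanSpace ℝ (Fin 3))) ht).comp_sub_right x₀

/-- `G · φ` is integrable for continuous `φ` of linear growth. -/
theorem integrable_G_mul_lin {φ : (EuclideanSpace ℝ (Fin 3)) → ℝ} (hφc : Continuous φ) {a b : ℝ} (h : ∀ x, ‖φ x‖ ≤ a + b * ‖x - x₀‖)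
    (ht : 0 < t) : Integrable (fun x : (EuclideanSpace ℝ (Fin 3)) => heatKernel t (x - x₀) * φ x) := by
  refine Integrable.mono' (((integrable_G x₀ ht).const_mul a).add ((integrable_G_mul_norm x₀ ht).const_mul b))
    ((continuous_G x₀ t).mul hφc).aestronglyMeasurable (ae_of_all _ fun x => ?_)
  have hG0 : 0 ≤ heatKernel t (x - x₀) := (heatKernel_pos ht _).le
  rw [norm_mul, Real.norm_of_nonneg hG0]
  calc heatKernel t (x - x₀) * ‖φ x‖ ≤ heatKernel t (x - x₀) * (a + b * ‖x - x₀‖) :=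
        mul_le_mul_of_nonneg_left (h x) hG0
    _ = a * heatKernel t (x - x₀) + b * (heatKernel t (x - x₀) * ‖x - x₀‖) := by ring

/-- `∂ⱼG · φ` is integrable for continuous `φ` of linear growth. -/
theorem integrable_fderivG_mul_lin {φ : (EuclideanSpace ℝ (Fin 3)) → ℝ} (hφc : Continuous φ) {a b : ℝ} (h : ∀ x, ‖φ x‖ ≤ a + b * ‖x - x₀‖)
    (ht : 0 < t) (j : Fin 3) :
    Integrable (fun x : (EuclideanSpace ℝ (Fin 3)) => fderiv ℝ (fun y : (EuclideanSpace ℝ (Fin 3)) => heatKernel t (y - x₀)) x (EuclideanSpace.single j 1) * φ x) := by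
  have hc : Continuous (fun x : (EuclideanSpace ℝ (Fin 3)) => fderiv ℝ (fun y : (EuclideanSpace ℝ (Fin 3)) => heatKernel t (y - x₀)) x (EuclideanSpace.single j 1)) := by
    have hfun : (fun x : (EuclideanSpace ℝ (Fin 3)) => fderiv ℝ (fun y : (EuclideanSpace ℝ (Fin 3)) => heatKernel t (y - x₀)) x (EuclideanSpace.single j 1)) =
        fun x => -(heatKernel t (x - x₀) / (2 * t)) * (x - x₀) j := by funext x; rw [fderiv_G_apply]
    rw [hfun]
    exact (((continuous_G x₀ t).div_const _).neg).mul
      ((EuclideanSpace.proj (𝕜 := ℝ) j).continuous.comp (continuous_id.sub continuous_const))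
  refine Integrable.mono'
    ((((integrable_G_mul_norm x₀ ht).const_mul (a / (2 * t))).add ((integrable_norm_sq_mul_G x₀ ht).const_mul (b / (2 * t)))))
    (hc.mul hφc).aestronglyMeasurable (ae_of_all _ fun x => ?_)
  have hG0 : 0 ≤ heatKernel t (x - x₀) := (heatKernel_pos ht _).le
  have hy : |(x - x₀) j| ≤ ‖x - x₀‖ := abs_coord_le_norm_e3 _ j
  rw [fderiv_G_apply, norm_mul, norm_mul, norm_neg, Real.norm_of_nonneg (by positivity : 0 ≤ heatKernel t (x - x₀) / (2 * t)),
    Real.norm_eq_abs]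
  calc heatKernel t (x - x₀) / (2 * t) * |(x - x₀) j| * ‖φ x‖
      ≤ heatKernel t (x - x₀) / (2 * t) * ‖x - x₀‖ * (a + b * ‖x - x₀‖) :=
        mul_le_mul (mul_le_mul_of_nonneg_left hy (by positivity)) (h x) (norm_nonneg _) (by positivity)
    _ = a / (2 * t) * (heatKernel t (x - x₀) * ‖x - x₀‖) + b / (2 * t) * (‖x - x₀‖ ^ 2 * heatKernel t (x - x₀)) := by
        ring

/-- Whole-space integration by parts against the Gaussian for `C¹` scalars of LINEAR GROWTH with linear-growth gradient:
`∫ G ∂ⱼφ = −∫ ∂ⱼG φ` (all three products integrable by the Gaussian first and second moments). -/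
theorem integral_G_mul_fderiv_eq_lin {φ : (EuclideanSpace ℝ (Fin 3)) → ℝ} (hφ : ContDiff ℝ 1 φ) {a b a' b' : ℝ}
    (h0 : ∀ x, ‖φ x‖ ≤ a + b * ‖x - x₀‖) (h1 : ∀ x, ‖fderiv ℝ φ x‖ ≤ a' + b' * ‖x - x₀‖) (ht : 0 < t) (j : Fin 3) :
    Integrable (fun x => heatKernel t (x - x₀) * fderiv ℝ φ x (EuclideanSpace.single j 1)) ∧
    Integrable (fun x => fderiv ℝ (fun y : (EuclideanSpace ℝ (Fin 3)) => heatKernel t (y - x₀)) x (EuclideanSpace.single j 1) * φ x) ∧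
    ∫ x, heatKernel t (x - x₀) * fderiv ℝ φ x (EuclideanSpace.single j 1) =
      -∫ x, fderiv ℝ (fun y : (EuclideanSpace ℝ (Fin 3)) => heatKernel t (y - x₀)) x (EuclideanSpace.single j 1) * φ x := by
  have hφc : Continuous φ := hφ.continuous
  have hφd : Differentiable ℝ φ := hφ.differentiable one_ne_zero
  have hDφc : Continuous (fun x => fderiv ℝ φ x (EuclideanSpace.single j 1)) :=
    (hφ.continuous_fderiv one_ne_zero).clm_apply continuous_const
  have hDφb : ∀ x, ‖fderiv ℝ φ x (EuclideanSpace.single j 1)‖ ≤ a' + b' * ‖x - x₀‖ := fun x => by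
    refine (ContinuousLinearMap.le_opNorm _ _).trans ?_
    have hn : ‖(EuclideanSpace.single j (1 : ℝ) : (EuclideanSpace ℝ (Fin 3)))‖ = 1 := by simp
    rw [hn, mul_one]; exact h1 x
  have I1 : Integrable (fun x => fderiv ℝ (fun y : (EuclideanSpace ℝ (Fin 3)) => heatKernel t (y - x₀)) x (EuclideanSpace.single j 1) * φ x) :=
    integrable_fderivG_mul_lin x₀ hφc h0 ht j
  have I2 : Integrable (fun x => heatKernel t (x - x₀) * fderiv ℝ φ x (EuclideanSpace.single j 1)) :=
    integrable_G_mul_lin x₀ hDφc hDφb ht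
  have I3 : Integrable (fun x => heatKernel t (x - x₀) * φ x) := integrable_G_mul_lin x₀ hφc h0 ht
  refine ⟨I2, I1, ?_⟩
  exact integral_mul_fderiv_eq_neg_fderiv_mul_of_integrable (μ := volume) I1 I2 I3
    (fun y _ => (hasFDerivAt_G x₀ t y).differentiableAt) (fun y _ => hφd y)

end Moments

end Summit.NavierStokesRegularity.NavierStokesRegularity.Theorems.HalfSpaceWindowDoorCirculationCarryingRigidityGaussKernel

end
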